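import Literature.NumberTheory.IwasawaTheory.ClassicalMuVanishesRelativeKleinDescent
import HarnessLib

set_option autoImplicit false

/-!
# Growth-fact-free μ-descent for Galois groups of split-Cartan-normaliser type `N_s(5) = (C₄ × C₄) ⋊ C₂` (e.g. `ℚ(E[5])`)

Topic `NumberTheory/IwasawaTheory` (namespace = path).  THEOREM-ONLY file (no definition, no named fact, no `sorry`); literature
seat `bsd-potss-conjA-anchor` g11 (supports stmt-BirchSwinnertonDyer-19413, KT rows with split Cartan image at `p = 5`; closes nothing).

`L/ℚ` finite Galois, `p` odd, `p ∤ [L : ℚ]`, and `u, v, w ∈ G = Gal(L/ℚ)` with the relations of `N_s(5) ⊂ GL₂(𝔽₅)`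
(`u = diag(i,1)`, `v = diag(1,i)`, `w` the swap; `i = 2`): `uv = vu`, `u⁴ = v⁴ = 1`, `w² = 1`, `w u w⁻¹ = v`, `w v w⁻¹ = u`, `uv` central,
`V₀ = ⟨u², v²⟩` normal, `[G, G] ≤ ⟨u v⁻¹⟩`.  Then `μ = 0` for every cyclotomic `ℤ_p`-extension of `L` follows — modulo
Ferrero–Washington ALONE (no growth theorem) — from `μ = 0` for every cyclotomic `ℤ_p`-extension of the four fields
`L^{⟨v⟩}` (`= ℚ(P₁)`, degree 8), `L^{⟨u² v⟩}` (degree 8), `L^{⟨u², v⟩}` (`= ℚ(x P₁)`, degree 4), `L^{⟨uv, w⟩}` (`= ℚ(C)`, `C` a non-axis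
cyclic subgroup of order 5, degree 4).  Road (all steps are Kuroda EQUALITIES at every layer, [Lemmermeyer1994] §1):
(1) Klein `{1, v², u², u²v²}` in `G` (`u² ~ v²` via `w`); (2) the RELATIVE Klein step for `L^{⟨v²⟩}` over `L^{⟨u², v⟩}`
(`classicalMuVanishes_of_isCyclotomic_of_relative_biquadratic`); (3) the central Klein four `{1, v̄², \overline{uv}, …}` of `G/⟨u²v²⟩`;
(4) `G/V₀ ≅ D₄` and (5) `G/⟨uv⟩ ≅ D₄` by the `D₄` form `classicalMuVanishes_of_isCyclotomic_of_kuroda_rat`.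

References: [Lemmermeyer1994, §1]; [Washington1997, §7.5, §13.1]; [MilneFT2022, Ch. 3]; [Serre1972, §2 (Cartan subgroups)].
-/

noncomputable section

open scoped NumberField

open Field IntermediateField Literature.NumberTheory.EllipticCurves

namespace Literature.NumberTheory.IwasawaTheory

variable {p : ℕ} [Fact p.Prime]

omit [Fact p.Prime] in
/-- `p ∤ [E : ℚ]` for an intermediate field `E` of `L/ℚ` when `p ∤ [L : ℚ]`. [folklore] -/
private theorem not_dvd_finrank_intermediateField₅ {L : Type} [Field L] [NumberField L]
    (hp : ¬ p ∣ Module.finrank ℚ L) (E : IntermediateField ℚ L) : ¬ p ∣ Module.finrank ℚ ↥E := fun h =>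
  hp (h.trans (Dvd.intro _ (Module.finrank_mul_finrank ℚ ↥E L)))

omit [Fact p.Prime] in
/-- For `N ⊴ Gal(L/F)`, `N ≤ H`, `M = L^N`: `M^{H̄} ≃ₐ[F] L^H` (`H̄` the image of `H` in `Gal(M/F)`). [folklore] -/
private theorem nonempty_algEquiv_fixedField_of_map_restrictNormalHom₅ {F L : Type} [Field F] [Field L] [Algebra F L]
    [FiniteDimensional F L] [IsGalois F L] (N H : Subgroup (L ≃ₐ[F] L)) [N.Normal] (hNH : N ≤ H)
    (H' : Subgroup (↥(fixedField N) ≃ₐ[F] ↥(fixedField N)))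
    (hH' : H.map (AlgEquiv.restrictNormalHom ↥(fixedField N)) = H') :
    Nonempty (↥(fixedField H') ≃ₐ[F] ↥(fixedField H)) := by
  have h1 := InfiniteGalois.restrict_fixedField H (fixedField N)
  rw [hH'] at h1
  have h2 : IntermediateField.lift (fixedField H') = fixedField H := by
    rw [← h1]
    exact inf_eq_left.mpr (IntermediateField.fixedField_le hNH)
  exact ⟨(IntermediateField.liftAlgEquiv (fixedField H')).trans (IntermediateField.equivOfEq h2)⟩

omit [Fact p.Prime] in
/-- An element commuting with `h` normalises `⟨h⟩`. [folklore] -/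
private theorem mem_normalizer_zpowers_of_commute {G : Type} [Group G] {g h : G} (hc : Commute g h) :
    g ∈ Subgroup.normalizer (Subgroup.zpowers h : Set G) := by
  rw [Subgroup.mem_normalizer_iff]
  intro k
  constructor
  · intro hk
    obtain ⟨m, rfl⟩ := Subgroup.mem_zpowers_iff.mp hk
    rw [(hc.zpow_right m).eq, mul_inv_cancel_right]
    exact hk
  · intro hk
    obtain ⟨m, hm⟩ := Subgroup.mem_zpowers_iff.mp hk
    have h1 : k = g⁻¹ * h ^ m * g := by rw [hm]; group
    rw [h1, (hc.inv_left.zpow_right m).eq, inv_mul_cancel_right]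
    exact Subgroup.zpow_mem _ (Subgroup.mem_zpowers h) m

omit [Fact p.Prime] in
/-- A central element generates a normal subgroup. [folklore] -/
private theorem normal_zpowers_of_central {G : Type} [Group G] {z : G} (hzc : ∀ g : G, g * z = z * g) :
    (Subgroup.zpowers z).Normal := by
  refine ⟨fun h hh a => ?_⟩
  obtain ⟨k, rfl⟩ := Subgroup.mem_zpowers_iff.mp hh
  have hc : Commute a z := hzc a
  rw [(hc.zpow_right k).eq, mul_inv_cancel_right]
  exact hh

omit [Fact p.Prime] in
/-- A subgroup containing all commutators is normal. [folklore] -/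
private theorem normal_of_commutator_mem {G : Type} [Group G] (S : Subgroup G) (h : ∀ a c : G, a * c * a⁻¹ * c⁻¹ ∈ S) :
    S.Normal := by
  refine ⟨fun k hk a => ?_⟩
  have h2 : a * k * a⁻¹ = (a * k * a⁻¹ * k⁻¹) * k := by group
  rw [h2]
  exact S.mul_mem (h a k) hk

omit [Fact p.Prime] in
/-- `⟨a, b⟩ = ⟨a⟩ ⊔ ⟨b⟩`. [folklore] -/
private theorem closure_pair_eq_sup {G : Type} [Group G] (a b : G) :
    Subgroup.closure ({a, b} : Set G) = Subgroup.zpowers a ⊔ Subgroup.zpowers b := by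
  rw [Set.insert_eq, Subgroup.closure_union, ← Subgroup.zpowers_eq_closure, ← Subgroup.zpowers_eq_closure]

/-- Transport of «`μ = 0` for every cyclotomic `ℤ_p`-extension» between fixed fields of EQUAL subgroups. [folklore] -/
private theorem forall_classicalMuVanishes_of_subgroup_eq {L : Type} [Field L] [NumberField L]
    (hp : ¬ p ∣ Module.finrank ℚ L) {S T : Subgroup (L ≃ₐ[ℚ] L)} (hST : S = T)
    (h : ∀ κE : ZpExtension ↥(fixedField S) p, κE.IsCyclotomic → ClassicalMuVanishes κE) :
    ∀ κE : ZpExtension ↥(fixedField T) p, κE.IsCyclotomic → ClassicalMuVanishes κE :=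
  forall_classicalMuVanishes_of_algEquiv (F := ℚ) (IntermediateField.equivOfEq (congrArg fixedField hST))
    (not_dvd_finrank_intermediateField₅ hp _) h

/-- Transport along conjugation: `L^{g S g⁻¹}` from `L^S`. [folklore] -/
private theorem forall_classicalMuVanishes_of_conj {L : Type} [Field L] [NumberField L]
    (hp : ¬ p ∣ Module.finrank ℚ L) (S T : Subgroup (L ≃ₐ[ℚ] L)) (g : L ≃ₐ[ℚ] L)
    (hST : S.map (MulAut.conj g).toMonoidHom = T)
    (h : ∀ κE : ZpExtension ↥(fixedField S) p, κE.IsCyclotomic → ClassicalMuVanishes κE) :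
    ∀ κE : ZpExtension ↥(fixedField T) p, κE.IsCyclotomic → ClassicalMuVanishes κE := by
  haveI : FiniteDimensional ℚ L := inferInstance
  obtain ⟨φ⟩ := nonempty_algEquiv_fixedField_conj (F := ℚ) S g
  exact forall_classicalMuVanishes_of_algEquiv (F := ℚ) (φ.trans (IntermediateField.equivOfEq (congrArg fixedField hST)))
    (not_dvd_finrank_intermediateField₅ hp _) h

/-- Transport to a quotient: for `N ⊴ G`, `N ≤ S`, `μ`-input for `L^S` gives `μ`-input for `(L^N)^{S̄}`. [folklore] -/
private theorem forall_classicalMuVanishes_quotient {L : Type} [Field L] [NumberField L] [IsGalois ℚ L]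
    (hp : ¬ p ∣ Module.finrank ℚ L) (N S : Subgroup (L ≃ₐ[ℚ] L)) [N.Normal] [IsGalois ℚ ↥(fixedField N)] (hNS : N ≤ S)
    (π : (L ≃ₐ[ℚ] L) →* (↥(fixedField N) ≃ₐ[ℚ] ↥(fixedField N))) (hπ : π = AlgEquiv.restrictNormalHom ↥(fixedField N))
    (S' : Subgroup (↥(fixedField N) ≃ₐ[ℚ] ↥(fixedField N))) (hS' : S.map π = S')
    (h : ∀ κE : ZpExtension ↥(fixedField S) p, κE.IsCyclotomic → ClassicalMuVanishes κE) :
    ∀ κE : ZpExtension ↥(fixedField S') p, κE.IsCyclotomic → ClassicalMuVanishes κE := by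
  subst hπ
  obtain ⟨e⟩ := nonempty_algEquiv_fixedField_of_map_restrictNormalHom₅ N S hNS S' hS'
  exact forall_classicalMuVanishes_of_algEquiv (F := ℚ) e.symm (not_dvd_finrank_intermediateField₅ hp _) h

set_option maxHeartbeats 800000 in
/-- **Step (4): `L^{V₀}`, `V₀ = ⟨u², v²⟩ ⊴ G`, `G/V₀ ≅ D₄`.**  `μ`-input for `L^{⟨u², v⟩}` (`= ℚ(x P₁)`; conjugated by `w` to
`L^{⟨v², u⟩} = L^{V₀ ⟨u⟩} = ℚ(x P₂)`) gives «`μ = 0` for every cyclotomic `ℤ_p`-extension of `L^{V₀}`», by the `D₄` form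
`classicalMuVanishes_of_isCyclotomic_of_kuroda_rat` for `Gal(L^{V₀}/ℚ)` with `z̄ = \overline{uv}`, `b̄ = ū`, conjugator `w̄`.
[cite: Lemmermeyer1994, §1 (Kuroda's class number formula, odd part)] [cite: Washington1997, §13.1, §7.5] [cite: MilneFT2022, Ch. 3] -/
theorem classicalMuVanishes_of_isCyclotomic_fixedField_sq_sup_sq (hFW : ferreroWashington1979_classicalMuVanishes)
    (hp2 : p ≠ 2) (L : Type) [Field L] [NumberField L] [IsGalois ℚ L] (hp : ¬ p ∣ Module.finrank ℚ L)
    {u v w : L ≃ₐ[ℚ] L} (huv : u * v = v * u) (hwu : w * u * w⁻¹ = v) (hwv : w * v * w⁻¹ = u)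
    (hsc : ∀ g : L ≃ₐ[ℚ] L, g * (u * v) = (u * v) * g)
    (hVu : ∀ g : L ≃ₐ[ℚ] L, g * (u * u) * g⁻¹ = u * u ∨ g * (u * u) * g⁻¹ = v * v)
    (hVv : ∀ g : L ≃ₐ[ℚ] L, g * (v * v) * g⁻¹ = u * u ∨ g * (v * v) * g⁻¹ = v * v)
    (hcomm : ∀ a c : L ≃ₐ[ℚ] L, a * c * a⁻¹ * c⁻¹ ∈ Subgroup.zpowers (u * v⁻¹))
    (hμX : ∀ κE : ZpExtension ↥(fixedField (Subgroup.zpowers (u * u) ⊔ Subgroup.zpowers v)) p,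
      κE.IsCyclotomic → ClassicalMuVanishes κE) :
    ∀ κE : ZpExtension ↥(fixedField (Subgroup.zpowers (u * u) ⊔ Subgroup.zpowers (v * v))) p,
      κE.IsCyclotomic → ClassicalMuVanishes κE := by
  have hc : Commute u v := huv
  obtain ⟨V₀, hV₀⟩ : ∃ V₀ : Subgroup (L ≃ₐ[ℚ] L), V₀ = Subgroup.zpowers (u * u) ⊔ Subgroup.zpowers (v * v) := ⟨_, rfl⟩
  have huuV : u * u ∈ V₀ := hV₀ ▸ Subgroup.mem_sup_left (Subgroup.mem_zpowers _)
  have hvvV : v * v ∈ V₀ := hV₀ ▸ Subgroup.mem_sup_right (Subgroup.mem_zpowers _)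
  -- `V₀` is normal
  haveI hVN : V₀.Normal := by
    refine ⟨fun n hn g => ?_⟩
    have hle : V₀.map (MulAut.conj g).toMonoidHom ≤ V₀ := by
      rw [hV₀, Subgroup.map_sup, MonoidHom.map_zpowers, MonoidHom.map_zpowers, ← hV₀]
      refine sup_le (Subgroup.zpowers_le.mpr ?_) (Subgroup.zpowers_le.mpr ?_)
      · rw [MulEquiv.coe_toMonoidHom, MulAut.conj_apply]
        rcases hVu g with h | h
        · rw [h]; exact huuV
        · rw [h]; exact hvvV
      · rw [MulEquiv.coe_toMonoidHom, MulAut.conj_apply]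
        rcases hVv g with h | h
        · rw [h]; exact huuV
        · rw [h]; exact hvvV
    have h1 : (MulAut.conj g).toMonoidHom n ∈ V₀.map (MulAut.conj g).toMonoidHom := Subgroup.mem_map_of_mem _ hn
    have h2 := hle h1
    rwa [MulEquiv.coe_toMonoidHom, MulAut.conj_apply] at h2
  rw [← hV₀]
  -- the quotient `Gal(L₀/ℚ)`, `L₀ = L^{V₀}`
  haveI : IsGalois ℚ ↥(fixedField V₀) := IsGalois.of_fixedField_normal_subgroup V₀
  have hp₀ : ¬ p ∣ Module.finrank ℚ ↥(fixedField V₀) := not_dvd_finrank_intermediateField₅ hp _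
  obtain ⟨π, hπ⟩ : ∃ π : (L ≃ₐ[ℚ] L) →* (↥(fixedField V₀) ≃ₐ[ℚ] ↥(fixedField V₀)),
      π = AlgEquiv.restrictNormalHom ↥(fixedField V₀) := ⟨_, rfl⟩
  have hπsurj : Function.Surjective π := hπ ▸ AlgEquiv.restrictNormalHom_surjective L
  have hker : ∀ g, π g = 1 ↔ g ∈ V₀ := by
    intro g
    have h1 := IntermediateField.restrictNormalHom_ker (K := ℚ) (L := L) (fixedField V₀)
    rw [IntermediateField.fixingSubgroup_fixedField] at h1
    rw [← MonoidHom.mem_ker, hπ]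
    exact SetLike.ext_iff.mp h1 g
  -- `z̄ = π(uv)`, `b̄ = π u`
  have hI3 : (u * v) * (u * v) = u * u * (v * v) := by
    calc (u * v) * (u * v) = u * (v * u) * v := by group
      _ = u * (u * v) * v := by rw [← huv]
      _ = u * u * (v * v) := by group
  have hz : π (u * v) * π (u * v) = 1 := by
    rw [← map_mul, hker, hI3]
    exact V₀.mul_mem huuV hvvV
  have hb : π u * π u = 1 := by rw [← map_mul, hker]; exact huuV
  have hzb : π (u * v) * π u = π u * π (u * v) := by rw [← map_mul, ← map_mul, hsc u]
  have hconj : ∃ g, g * π u * g⁻¹ = π (u * v) * π u := by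
    refine ⟨π w, ?_⟩
    have h1 : π ((u * v * u)⁻¹ * v) = 1 := by
      rw [hker]
      have h2 : (u * v * u)⁻¹ * v = (u * u)⁻¹ := by
        calc (u * v * u)⁻¹ * v = u⁻¹ * (v⁻¹ * u⁻¹) * v := by group
          _ = u⁻¹ * (u⁻¹ * v⁻¹) * v := by rw [← hc.inv_inv.eq]
          _ = (u * u)⁻¹ := by group
      rw [h2]
      exact V₀.inv_mem huuV
    rw [map_mul, map_inv, inv_mul_eq_one] at h1
    rw [← map_mul, ← map_inv, ← map_mul, hwu, ← map_mul, h1]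
  have hcomm' : ∀ a c : ↥(fixedField V₀) ≃ₐ[ℚ] ↥(fixedField V₀), a * c * a⁻¹ * c⁻¹ ∈ Subgroup.zpowers (π (u * v)) := by
    intro a c
    obtain ⟨a, rfl⟩ := hπsurj a
    obtain ⟨c, rfl⟩ := hπsurj c
    have h1 : π (a * c * a⁻¹ * c⁻¹) ∈ (Subgroup.zpowers (u * v⁻¹)).map π := Subgroup.mem_map_of_mem π (hcomm a c)
    have h2 : π (u * v⁻¹) = π (u * v) := by
      have h3 : u * v = u * v⁻¹ * (v * v) := by group
      rw [h3, map_mul π (u * v⁻¹) (v * v), (hker (v * v)).mpr hvvV, mul_one]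
    rw [map_mul, map_mul, map_mul, map_inv, map_inv, MonoidHom.map_zpowers, h2] at h1
    exact h1
  -- the `μ`-input for `L₀^{⟨b̄⟩} ≅ L^{V₀ ⊔ ⟨u⟩} = L^{⟨v²⟩ ⊔ ⟨u⟩} ≅ L^{⟨u²⟩ ⊔ ⟨v⟩}` (conjugation by `w`)
  have hwuu : w * (u * u) * w⁻¹ = v * v := by
    calc w * (u * u) * w⁻¹ = (w * u * w⁻¹) * (w * u * w⁻¹) := by group
      _ = v * v := by rw [hwu]
  have hmapw : (Subgroup.zpowers (u * u) ⊔ Subgroup.zpowers v).map (MulAut.conj w).toMonoidHom =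
      Subgroup.zpowers (v * v) ⊔ Subgroup.zpowers u := by
    rw [Subgroup.map_sup, MonoidHom.map_zpowers, MonoidHom.map_zpowers, MulEquiv.coe_toMonoidHom, MulAut.conj_apply,
      MulAut.conj_apply, hwuu, hwv]
  have heq : Subgroup.zpowers (v * v) ⊔ Subgroup.zpowers u = V₀ ⊔ Subgroup.zpowers u := by
    refine le_antisymm (sup_le (Subgroup.zpowers_le.mpr (Subgroup.mem_sup_left hvvV)) le_sup_right)
      (sup_le ?_ le_sup_right)
    rw [hV₀]
    exact sup_le (Subgroup.zpowers_le.mpr (Subgroup.mem_sup_right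
      ((Subgroup.zpowers u).mul_mem (Subgroup.mem_zpowers u) (Subgroup.mem_zpowers u))))
      (Subgroup.zpowers_le.mpr (Subgroup.mem_sup_left (Subgroup.mem_zpowers _)))
  have hV₀π : V₀.map π = ⊥ := by
    rw [Subgroup.map_eq_bot_iff]
    intro g hg
    rw [MonoidHom.mem_ker]
    exact (hker g).mpr hg
  have hmapπ : (V₀ ⊔ Subgroup.zpowers u).map π = Subgroup.zpowers (π u) := by
    rw [Subgroup.map_sup, MonoidHom.map_zpowers, hV₀π, bot_sup_eq]
  have hμb : ∀ κE : ZpExtension ↥(fixedField (Subgroup.zpowers (π u))) p, κE.IsCyclotomic → ClassicalMuVanishes κE :=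
    forall_classicalMuVanishes_quotient hp V₀ (V₀ ⊔ Subgroup.zpowers u) le_sup_left π hπ _ hmapπ
      (forall_classicalMuVanishes_of_subgroup_eq hp heq (forall_classicalMuVanishes_of_conj hp _ _ w hmapw hμX))
  exact classicalMuVanishes_of_isCyclotomic_of_kuroda_rat hFW hp2 ↥(fixedField V₀) hp₀ hz hb hzb hconj hcomm' hμb

set_option maxHeartbeats 800000 in
/-- **Step (5): `L₂ = L^{⟨uv⟩}` (`uv` central), `G/⟨uv⟩ ≅ D₄` with rotation `ū` and reflection `w̄`.**  `μ`-input for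
`L^{⟨uv⟩ ⊔ ⟨w⟩}` (`= ℚ(C)`) gives «`μ = 0` for every cyclotomic `ℤ_p`-extension of `L^{⟨uv⟩}`» (`D₄` form with `z̄ = ū²`, `b̄ = w̄`,
conjugator `ū`). [cite: Lemmermeyer1994, §1 (Kuroda's class number formula, odd part)] [cite: Washington1997, §13.1, §7.5]
[cite: MilneFT2022, Ch. 3] -/
theorem classicalMuVanishes_of_isCyclotomic_fixedField_zpowers_mul (hFW : ferreroWashington1979_classicalMuVanishes)
    (hp2 : p ≠ 2) (L : Type) [Field L] [NumberField L] [IsGalois ℚ L] (hp : ¬ p ∣ Module.finrank ℚ L)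
    {u v w : L ≃ₐ[ℚ] L} (huv : u * v = v * u) (hu4 : u * u * (u * u) = 1) (hw2 : w * w = 1)
    (hwu : w * u * w⁻¹ = v) (hwv : w * v * w⁻¹ = u) (hsc : ∀ g : L ≃ₐ[ℚ] L, g * (u * v) = (u * v) * g)
    (hcomm : ∀ a c : L ≃ₐ[ℚ] L, a * c * a⁻¹ * c⁻¹ ∈ Subgroup.zpowers (u * v⁻¹))
    (hμC : ∀ κE : ZpExtension ↥(fixedField (Subgroup.zpowers (u * v) ⊔ Subgroup.zpowers w)) p,
      κE.IsCyclotomic → ClassicalMuVanishes κE) :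
    ∀ κE : ZpExtension ↥(fixedField (Subgroup.zpowers (u * v))) p, κE.IsCyclotomic → ClassicalMuVanishes κE := by
  obtain ⟨C, hC⟩ : ∃ C : Subgroup (L ≃ₐ[ℚ] L), C = Subgroup.zpowers (u * v) := ⟨_, rfl⟩
  haveI hCN : C.Normal := hC ▸ normal_zpowers_of_central hsc
  rw [← hC]
  haveI : IsGalois ℚ ↥(fixedField C) := IsGalois.of_fixedField_normal_subgroup C
  have hp₀ : ¬ p ∣ Module.finrank ℚ ↥(fixedField C) := not_dvd_finrank_intermediateField₅ hp _
  obtain ⟨π, hπ⟩ : ∃ π : (L ≃ₐ[ℚ] L) →* (↥(fixedField C) ≃ₐ[ℚ] ↥(fixedField C)),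
      π = AlgEquiv.restrictNormalHom ↥(fixedField C) := ⟨_, rfl⟩
  have hπsurj : Function.Surjective π := hπ ▸ AlgEquiv.restrictNormalHom_surjective L
  have hker : ∀ g, π g = 1 ↔ g ∈ C := by
    intro g
    have h1 := IntermediateField.restrictNormalHom_ker (K := ℚ) (L := L) (fixedField C)
    rw [IntermediateField.fixingSubgroup_fixedField] at h1
    rw [← MonoidHom.mem_ker, hπ]
    exact SetLike.ext_iff.mp h1 g
  have huvC : u * v ∈ C := hC ▸ Subgroup.mem_zpowers _
  have hπuv : π (u * v) = 1 := (hker _).mpr huvC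
  -- identities in `G`
  have hI3 : (u * v) * (u * v) = u * u * (v * v) := by
    calc (u * v) * (u * v) = u * (v * u) * v := by group
      _ = u * (u * v) * v := by rw [← huv]
      _ = u * u * (v * v) := by group
  have hwuu : w * (u * u) * w⁻¹ = v * v := by
    calc w * (u * u) * w⁻¹ = (w * u * w⁻¹) * (w * u * w⁻¹) := by group
      _ = v * v := by rw [hwu]
  have hwinv : w⁻¹ = w := inv_eq_of_mul_eq_one_right hw2
  have hwuu' : w * (u * u) * w = v * v := by
    have h := hwuu
    rwa [hwinv] at h
  have ha : u * u * w = w * (v * v) := by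
    calc u * u * w = (w * w) * (u * u) * w := by rw [hw2, one_mul]
      _ = w * (w * (u * u) * w) := by group
      _ = w * (v * v) := by rw [hwuu']
  have hb' : v * v = (u * u)⁻¹ * ((u * v) * (u * v)) := by rw [hI3]; group
  have hwvinv : w * v⁻¹ = u⁻¹ * w := by
    calc w * v⁻¹ = (w * v * w⁻¹)⁻¹ * w := by group
      _ = u⁻¹ * w := by rw [hwv]
  have hcid : u * w * u⁻¹ = u * u * w * (u * v)⁻¹ := by
    calc u * w * u⁻¹ = u * u * (u⁻¹ * w) * u⁻¹ := by group
      _ = u * u * (w * v⁻¹) * u⁻¹ := by rw [← hwvinv]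
      _ = u * u * w * (u * v)⁻¹ := by group
  have hd : u * v⁻¹ = u * u * (u * v)⁻¹ := by
    calc u * v⁻¹ = u * u * (v * u)⁻¹ := by group
      _ = u * u * (u * v)⁻¹ := by rw [← huv]
  -- `z̄ = π(u²)`, `b̄ = π w`
  have hz : π (u * u) * π (u * u) = 1 := by rw [← map_mul, hu4, map_one]
  have hzinv : (π (u * u))⁻¹ = π (u * u) := inv_eq_of_mul_eq_one_right hz
  have hπvv : π (v * v) = π (u * u) := by
    rw [hb', map_mul, map_inv, map_mul π (u * v) (u * v), hπuv, mul_one, mul_one, hzinv]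
  have hb : π w * π w = 1 := by rw [← map_mul, hw2, map_one]
  have hzb : π (u * u) * π w = π w * π (u * u) := by
    rw [← map_mul, ha, map_mul, hπvv]
  have hconj : ∃ g, g * π w * g⁻¹ = π (u * u) * π w := by
    refine ⟨π u, ?_⟩
    rw [← map_inv, ← map_mul, ← map_mul, hcid, map_mul, map_inv, hπuv, inv_one, mul_one, map_mul]
  have hcomm' : ∀ a c : ↥(fixedField C) ≃ₐ[ℚ] ↥(fixedField C), a * c * a⁻¹ * c⁻¹ ∈ Subgroup.zpowers (π (u * u)) := by
    intro a c
    obtain ⟨a, rfl⟩ := hπsurj a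
    obtain ⟨c, rfl⟩ := hπsurj c
    have h1 : π (a * c * a⁻¹ * c⁻¹) ∈ (Subgroup.zpowers (u * v⁻¹)).map π := Subgroup.mem_map_of_mem π (hcomm a c)
    have h2 : π (u * v⁻¹) = π (u * u) := by
      rw [hd, map_mul π (u * u) (u * v)⁻¹, map_inv, hπuv, inv_one, mul_one]
    rw [map_mul, map_mul, map_mul, map_inv, map_inv, MonoidHom.map_zpowers, h2] at h1
    exact h1
  -- `μ`-input for `L₂^{⟨w̄⟩} ≅ L^{C ⊔ ⟨w⟩}`
  have hCπ : C.map π = ⊥ := by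
    rw [Subgroup.map_eq_bot_iff]
    intro g hg
    rw [MonoidHom.mem_ker]
    exact (hker g).mpr hg
  have hmapπ : (C ⊔ Subgroup.zpowers w).map π = Subgroup.zpowers (π w) := by
    rw [Subgroup.map_sup, MonoidHom.map_zpowers, hCπ, bot_sup_eq]
  have hμb : ∀ κE : ZpExtension ↥(fixedField (Subgroup.zpowers (π w))) p, κE.IsCyclotomic → ClassicalMuVanishes κE :=
    forall_classicalMuVanishes_quotient hp C (C ⊔ Subgroup.zpowers w) le_sup_left π hπ _ hmapπ (by rw [hC]; exact hμC)
  exact classicalMuVanishes_of_isCyclotomic_of_kuroda_rat hFW hp2 ↥(fixedField C) hp₀ hz hb hzb hconj hcomm' hμb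

set_option maxHeartbeats 800000 in
/-- **Step (3): `M = L^{⟨v²u²⟩}` (`v²u² = (uv)²` central) and the CENTRAL Klein four `{1, v̄², \overline{uv}, v̄² \overline{uv}}` of
`Gal(M/ℚ)`.**  Supports: `L^{⟨u², v²⟩}` (step 4), `L^{⟨uv⟩}` (step 5), and the abelian `L^{⟨(uv)², v²·uv⟩} ⊇`-`[G,G]`-fixed fields
(Ferrero–Washington). [cite: Lemmermeyer1994, §1 (Kuroda's class number formula, odd part)] [cite: Washington1997, §13.1, §7.5]
[cite: MilneFT2022, Ch. 3] -/
theorem classicalMuVanishes_of_isCyclotomic_fixedField_zpowers_sq_mul_sq (hFW : ferreroWashington1979_classicalMuVanishes)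
    (hp2 : p ≠ 2) (L : Type) [Field L] [NumberField L] [IsGalois ℚ L] (hp : ¬ p ∣ Module.finrank ℚ L)
    {u v : L ≃ₐ[ℚ] L} (huv : u * v = v * u) (hv4 : v * v * (v * v) = 1)
    (hsc : ∀ g : L ≃ₐ[ℚ] L, g * (u * v) = (u * v) * g)
    (hcomm : ∀ a c : L ≃ₐ[ℚ] L, a * c * a⁻¹ * c⁻¹ ∈ Subgroup.zpowers (u * v⁻¹))
    (hμV : ∀ κE : ZpExtension ↥(fixedField (Subgroup.zpowers (u * u) ⊔ Subgroup.zpowers (v * v))) p,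
      κE.IsCyclotomic → ClassicalMuVanishes κE)
    (hμ₂ : ∀ κE : ZpExtension ↥(fixedField (Subgroup.zpowers (u * v))) p, κE.IsCyclotomic → ClassicalMuVanishes κE) :
    ∀ κE : ZpExtension ↥(fixedField (Subgroup.zpowers (v * v * (u * u)))) p, κE.IsCyclotomic → ClassicalMuVanishes κE := by
  have hc : Commute u v := huv
  -- identities in `G`
  have hI3 : (u * v) * (u * v) = u * u * (v * v) := by
    calc (u * v) * (u * v) = u * (v * u) * v := by group
      _ = u * (u * v) * v := by rw [← huv]
      _ = u * u * (v * v) := by group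
  have hI3b : v * v * (u * u) = u * u * (v * v) :=
    ((hc.symm.mul_right hc.symm).mul_left (hc.symm.mul_right hc.symm)).eq
  have hI5 : v * v * (u * u) = (u * v) * (u * v) := hI3b.trans hI3.symm
  have hvinv : v⁻¹ = v * v * v := inv_eq_of_mul_eq_one_right (by rw [← hv4]; group)
  have hcvv : u * (v * v) = v * v * u := (hc.mul_right hc).eq
  have hI4 : u * v⁻¹ = v * v * (u * v) := by
    calc u * v⁻¹ = (u * (v * v)) * v := by rw [hvinv]; group
      _ = (v * v * u) * v := by rw [hcvv]
      _ = v * v * (u * v) := by group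
  obtain ⟨Z, hZ⟩ : ∃ Z : Subgroup (L ≃ₐ[ℚ] L), Z = Subgroup.zpowers (v * v * (u * u)) := ⟨_, rfl⟩
  have hzcc : ∀ g : L ≃ₐ[ℚ] L, g * (v * v * (u * u)) = v * v * (u * u) * g := by
    intro g
    rw [hI5]
    calc g * ((u * v) * (u * v)) = (g * (u * v)) * (u * v) := by group
      _ = ((u * v) * g) * (u * v) := by rw [hsc g]
      _ = (u * v) * (g * (u * v)) := by group
      _ = (u * v) * ((u * v) * g) := by rw [hsc g]
      _ = (u * v) * (u * v) * g := by group
  haveI hZN : Z.Normal := hZ ▸ normal_zpowers_of_central hzcc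
  rw [← hZ]
  haveI : IsGalois ℚ ↥(fixedField Z) := IsGalois.of_fixedField_normal_subgroup Z
  have hp₀ : ¬ p ∣ Module.finrank ℚ ↥(fixedField Z) := not_dvd_finrank_intermediateField₅ hp _
  obtain ⟨π, hπ⟩ : ∃ π : (L ≃ₐ[ℚ] L) →* (↥(fixedField Z) ≃ₐ[ℚ] ↥(fixedField Z)),
      π = AlgEquiv.restrictNormalHom ↥(fixedField Z) := ⟨_, rfl⟩
  have hπsurj : Function.Surjective π := hπ ▸ AlgEquiv.restrictNormalHom_surjective L
  have hker : ∀ g, π g = 1 ↔ g ∈ Z := by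
    intro g
    have h1 := IntermediateField.restrictNormalHom_ker (K := ℚ) (L := L) (fixedField Z)
    rw [IntermediateField.fixingSubgroup_fixedField] at h1
    rw [← MonoidHom.mem_ker, hπ]
    exact SetLike.ext_iff.mp h1 g
  have hzcZ : v * v * (u * u) ∈ Z := hZ ▸ Subgroup.mem_zpowers _
  have hπzc : π (v * v * (u * u)) = 1 := (hker _).mpr hzcZ
  have hZπ : Z.map π = ⊥ := by
    rw [Subgroup.map_eq_bot_iff]
    intro g hg
    rw [MonoidHom.mem_ker]
    exact (hker g).mpr hg
  -- the central Klein four `z̄ = π(v²)`, `b̄ = π(uv)`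
  have hz : π (v * v) * π (v * v) = 1 := by rw [← map_mul, hv4, map_one]
  have hb : π (u * v) * π (u * v) = 1 := by rw [← map_mul, ← hI5, hπzc]
  have hzb : π (v * v) * π (u * v) = π (u * v) * π (v * v) := by rw [← map_mul, ← map_mul, hsc (v * v)]
  -- (a) `M^{z̄} ≅ L^{Z ⊔ ⟨v²⟩} = L^{⟨u²⟩ ⊔ ⟨v²⟩}`
  have heqa : Subgroup.zpowers (u * u) ⊔ Subgroup.zpowers (v * v) = Z ⊔ Subgroup.zpowers (v * v) := by
    refine le_antisymm (sup_le (Subgroup.zpowers_le.mpr ?_) le_sup_right) (sup_le ?_ le_sup_right)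
    · have h1 : u * u = (v * v)⁻¹ * (v * v * (u * u)) := by group
      rw [h1]
      exact (Z ⊔ _).mul_mem ((Z ⊔ _).inv_mem (Subgroup.mem_sup_right (Subgroup.mem_zpowers _)))
        (Subgroup.mem_sup_left hzcZ)
    · rw [hZ, Subgroup.zpowers_le]
      exact (_ ⊔ _ : Subgroup (L ≃ₐ[ℚ] L)).mul_mem (Subgroup.mem_sup_right (Subgroup.mem_zpowers _))
        (Subgroup.mem_sup_left (Subgroup.mem_zpowers _))
  have hmapa : (Z ⊔ Subgroup.zpowers (v * v)).map π = Subgroup.zpowers (π (v * v)) := by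
    rw [Subgroup.map_sup, MonoidHom.map_zpowers, hZπ, bot_sup_eq]
  have hμa : ∀ κE : ZpExtension ↥(fixedField (Subgroup.zpowers (π (v * v)))) p,
      κE.IsCyclotomic → ClassicalMuVanishes κE :=
    forall_classicalMuVanishes_quotient hp Z _ le_sup_left π hπ _ hmapa (forall_classicalMuVanishes_of_subgroup_eq hp heqa hμV)
  -- (b) `M^{b̄} ≅ L^{Z ⊔ ⟨uv⟩} = L^{⟨uv⟩}`
  have heqb : Subgroup.zpowers (u * v) = Z ⊔ Subgroup.zpowers (u * v) := by
    refine le_antisymm le_sup_right (sup_le ?_ le_rfl)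
    rw [hZ, Subgroup.zpowers_le, hI5]
    exact (Subgroup.zpowers _).mul_mem (Subgroup.mem_zpowers _) (Subgroup.mem_zpowers _)
  have hmapb : (Z ⊔ Subgroup.zpowers (u * v)).map π = Subgroup.zpowers (π (u * v)) := by
    rw [Subgroup.map_sup, MonoidHom.map_zpowers, hZπ, bot_sup_eq]
  have hμb : ∀ κE : ZpExtension ↥(fixedField (Subgroup.zpowers (π (u * v)))) p,
      κE.IsCyclotomic → ClassicalMuVanishes κE :=
    forall_classicalMuVanishes_quotient hp Z _ le_sup_left π hπ _ hmapb (forall_classicalMuVanishes_of_subgroup_eq hp heqb hμ₂)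
  -- (c) `M^{z̄ b̄} ≅ L^{Z ⊔ ⟨v²·uv⟩}`, abelian since `u v⁻¹ = v²·uv`
  obtain ⟨Sc, hSc⟩ : ∃ Sc : Subgroup (L ≃ₐ[ℚ] L), Sc = Z ⊔ Subgroup.zpowers (v * v * (u * v)) := ⟨_, rfl⟩
  have hcommc : ∀ a c : L ≃ₐ[ℚ] L, a * c * a⁻¹ * c⁻¹ ∈ Sc := fun a c =>
    (Subgroup.zpowers_le.mpr (by rw [hI4, hSc]; exact Subgroup.mem_sup_right (Subgroup.mem_zpowers _))) (hcomm a c)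
  haveI : Sc.Normal := normal_of_commutator_mem Sc hcommc
  haveI : IsAbelianGalois ℚ ↥(fixedField Sc) := isAbelianGalois_fixedField_of_commutator_mem Sc hcommc
  have hmapc : Sc.map π = Subgroup.zpowers (π (v * v) * π (u * v)) := by
    rw [hSc, Subgroup.map_sup, MonoidHom.map_zpowers, hZπ, bot_sup_eq, map_mul π (v * v) (u * v)]
  have hμc : ∀ κE : ZpExtension ↥(fixedField (Subgroup.zpowers (π (v * v) * π (u * v)))) p,
      κE.IsCyclotomic → ClassicalMuVanishes κE :=
    forall_classicalMuVanishes_quotient hp Z Sc (hSc ▸ le_sup_left) π hπ _ hmapc (fun κE hκE => hFW _ p κE hκE)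
  -- (d) `M^{⟨z̄, b̄⟩} ≅ L^{Z ⊔ (⟨v²⟩ ⊔ ⟨uv⟩)}`, abelian
  obtain ⟨Sd, hSd⟩ : ∃ Sd : Subgroup (L ≃ₐ[ℚ] L), Sd = Z ⊔ (Subgroup.zpowers (v * v) ⊔ Subgroup.zpowers (u * v)) :=
    ⟨_, rfl⟩
  have hcommd : ∀ a c : L ≃ₐ[ℚ] L, a * c * a⁻¹ * c⁻¹ ∈ Sd := fun a c =>
    (Subgroup.zpowers_le.mpr (by
      rw [hI4, hSd]
      exact Subgroup.mem_sup_right ((_ ⊔ _ : Subgroup (L ≃ₐ[ℚ] L)).mul_mem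
        (Subgroup.mem_sup_left (Subgroup.mem_zpowers _)) (Subgroup.mem_sup_right (Subgroup.mem_zpowers _)))))
      (hcomm a c)
  haveI : Sd.Normal := normal_of_commutator_mem Sd hcommd
  haveI : IsAbelianGalois ℚ ↥(fixedField Sd) := isAbelianGalois_fixedField_of_commutator_mem Sd hcommd
  have hmapd : Sd.map π = Subgroup.closure {π (v * v), π (u * v)} := by
    rw [hSd, Subgroup.map_sup, Subgroup.map_sup, MonoidHom.map_zpowers, MonoidHom.map_zpowers, hZπ, bot_sup_eq,
      closure_pair_eq_sup]
  have hμd : ∀ κE : ZpExtension ↥(fixedField (Subgroup.closure {π (v * v), π (u * v)})) p,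
      κE.IsCyclotomic → ClassicalMuVanishes κE :=
    forall_classicalMuVanishes_quotient hp Z Sd (hSd ▸ le_sup_left) π hπ _ hmapd (fun κE hκE => hFW _ p κE hκE)
  exact classicalMuVanishes_of_isCyclotomic_of_biquadratic hp2 ↥(fixedField Z) hp₀ hz hb hzb hμa hμb hμc hμd

set_option maxHeartbeats 800000 in
/-- **Step (2): the RELATIVE Klein step for `L^{⟨v²⟩}` over `L^{⟨u², v⟩}` (`H'/N = ⟨u², v⟩/⟨v²⟩ ≅ V₄`).**  Supports:
`L^{⟨v²⟩⟨u²⟩} = L^{⟨u², v²⟩}` (step 4), `L^{⟨v⟩}` (`= ℚ(P₁)`), `L^{⟨u² v⟩}`, `L^{⟨u², v⟩}` (`= ℚ(x P₁)`).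
[cite: Lemmermeyer1994, §1 (Kuroda's class number formula, odd part)] [cite: Washington1997, §13.1] [cite: MilneFT2022, Ch. 3] -/
theorem classicalMuVanishes_of_isCyclotomic_fixedField_zpowers_sq (hp2 : p ≠ 2) (L : Type) [Field L] [NumberField L]
    [IsGalois ℚ L] (hp : ¬ p ∣ Module.finrank ℚ L) {u v : L ≃ₐ[ℚ] L} (huv : u * v = v * u) (hu4 : u * u * (u * u) = 1)
    (hμV : ∀ κE : ZpExtension ↥(fixedField (Subgroup.zpowers (u * u) ⊔ Subgroup.zpowers (v * v))) p,
      κE.IsCyclotomic → ClassicalMuVanishes κE)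
    (hμP : ∀ κE : ZpExtension ↥(fixedField (Subgroup.zpowers v)) p, κE.IsCyclotomic → ClassicalMuVanishes κE)
    (hμD : ∀ κE : ZpExtension ↥(fixedField (Subgroup.zpowers (u * u * v))) p, κE.IsCyclotomic → ClassicalMuVanishes κE)
    (hμX : ∀ κE : ZpExtension ↥(fixedField (Subgroup.zpowers (u * u) ⊔ Subgroup.zpowers v)) p,
      κE.IsCyclotomic → ClassicalMuVanishes κE) :
    ∀ κE : ZpExtension ↥(fixedField (Subgroup.zpowers (v * v))) p, κE.IsCyclotomic → ClassicalMuVanishes κE := by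
  have hc : Commute u v := huv
  have hN_le_v : Subgroup.zpowers (v * v) ≤ Subgroup.zpowers v :=
    Subgroup.zpowers_le.mpr ((Subgroup.zpowers v).mul_mem (Subgroup.mem_zpowers v) (Subgroup.mem_zpowers v))
  have hx : u * u ∈ Subgroup.normalizer (Subgroup.zpowers (v * v) : Set (L ≃ₐ[ℚ] L)) :=
    mem_normalizer_zpowers_of_commute ((hc.mul_right hc).mul_left (hc.mul_right hc))
  have hy : v ∈ Subgroup.normalizer (Subgroup.zpowers (v * v) : Set (L ≃ₐ[ℚ] L)) :=
    mem_normalizer_zpowers_of_commute ((Commute.refl v).mul_right (Commute.refl v))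
  have hxx : u * u * (u * u) ∈ Subgroup.zpowers (v * v) := by rw [hu4]; exact Subgroup.one_mem _
  have hyy : v * v ∈ Subgroup.zpowers (v * v) := Subgroup.mem_zpowers _
  have hxy : u * u * v * (u * u)⁻¹ * v⁻¹ ∈ Subgroup.zpowers (v * v) := by
    rw [(hc.mul_left hc).eq, show v * (u * u) * (u * u)⁻¹ * v⁻¹ = 1 by group]
    exact Subgroup.one_mem _
  have heqX : Subgroup.zpowers (u * u) ⊔ Subgroup.zpowers (v * v) = Subgroup.zpowers (v * v) ⊔ Subgroup.zpowers (u * u) :=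
    sup_comm _ _
  have heqY : Subgroup.zpowers v = Subgroup.zpowers (v * v) ⊔ Subgroup.zpowers v := (sup_eq_right.mpr hN_le_v).symm
  have heqXY : Subgroup.zpowers (u * u * v) = Subgroup.zpowers (v * v) ⊔ Subgroup.zpowers (u * u * v) := by
    refine (sup_eq_right.mpr (Subgroup.zpowers_le.mpr ?_)).symm
    have h1 : v * v = (u * u * v) * (u * u * v) := by
      calc v * v = u * u * (u * u) * (v * v) := by rw [hu4, one_mul]
        _ = u * u * (u * u * v) * v := by group
        _ = u * u * (v * (u * u)) * v := by rw [(hc.mul_left hc).eq]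
        _ = (u * u * v) * (u * u * v) := by group
    rw [h1]
    exact (Subgroup.zpowers _).mul_mem (Subgroup.mem_zpowers _) (Subgroup.mem_zpowers _)
  have heqC : Subgroup.zpowers (u * u) ⊔ Subgroup.zpowers v =
      Subgroup.zpowers (v * v) ⊔ Subgroup.zpowers (u * u) ⊔ Subgroup.zpowers v :=
    le_antisymm (sup_le (le_sup_right.trans le_sup_left) le_sup_right)
      (sup_le (sup_le (hN_le_v.trans le_sup_right) le_sup_left) le_sup_right)
  exact classicalMuVanishes_of_isCyclotomic_of_relative_biquadratic hp2 L hp (Subgroup.zpowers (v * v)) hx hy hxx hyy hxy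
    (forall_classicalMuVanishes_of_subgroup_eq hp heqX hμV) (forall_classicalMuVanishes_of_subgroup_eq hp heqY hμP)
    (forall_classicalMuVanishes_of_subgroup_eq hp heqXY hμD) (forall_classicalMuVanishes_of_subgroup_eq hp heqC hμX)

set_option maxHeartbeats 800000 in
/-- **`N_s(5)` census form, growth-fact-free: `μ(L) = 0 ⟸ μ = 0` for `L^{⟨v⟩}`, `L^{⟨u²v⟩}`, `L^{⟨u², v⟩}`, `L^{⟨uv, w⟩}` modulo
Ferrero–Washington.**  `L/ℚ` finite Galois, `p` odd, `p ∤ [L : ℚ]`; `u, v, w ∈ Gal(L/ℚ)` with `uv = vu`, `u⁴ = v⁴ = 1`, `w² = 1`,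
`w u w⁻¹ = v`, `w v w⁻¹ = u`, `uv` central, `⟨u², v²⟩` normal (as the displayed alternatives), `[G,G] ≤ ⟨u v⁻¹⟩`.  For `L = ℚ(E[5])` with
`Gal ≅ N_s(5)`: `u = diag(2,1)`, `v = diag(1,2)`, `w = (0 1; 1 0)`; `L^{⟨v⟩} = ℚ(P₁)` (`P₁` on the first axis, degree 8), `L^{⟨u²v⟩}`
(degree 8), `L^{⟨u²,v⟩} = ℚ(x P₁)` (degree 4), `L^{⟨uv,w⟩} = ℚ(C)` (`C = ⟨(1,1)⟩`, degree 4).  Steps (1)–(5) of the module docstring;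
no growth theorem. [cite: Lemmermeyer1994, §1 (Kuroda's class number formula, odd part)] [cite: Washington1997, §13.1, §7.5]
[cite: MilneFT2022, Ch. 3 (fundamental theorem of Galois theory)] [cite: Serre1972, §2 (split Cartan subgroups and normalisers)] -/
theorem classicalMuVanishes_of_isCyclotomic_of_splitCartan_kuroda_rat (hFW : ferreroWashington1979_classicalMuVanishes)
    (hp2 : p ≠ 2) (L : Type) [Field L] [NumberField L] [IsGalois ℚ L] (hp : ¬ p ∣ Module.finrank ℚ L)
    {u v w : L ≃ₐ[ℚ] L} (huv : u * v = v * u) (hu4 : u * u * (u * u) = 1) (hv4 : v * v * (v * v) = 1) (hw2 : w * w = 1)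
    (hwu : w * u * w⁻¹ = v) (hwv : w * v * w⁻¹ = u) (hsc : ∀ g : L ≃ₐ[ℚ] L, g * (u * v) = (u * v) * g)
    (hVu : ∀ g : L ≃ₐ[ℚ] L, g * (u * u) * g⁻¹ = u * u ∨ g * (u * u) * g⁻¹ = v * v)
    (hVv : ∀ g : L ≃ₐ[ℚ] L, g * (v * v) * g⁻¹ = u * u ∨ g * (v * v) * g⁻¹ = v * v)
    (hcomm : ∀ a c : L ≃ₐ[ℚ] L, a * c * a⁻¹ * c⁻¹ ∈ Subgroup.zpowers (u * v⁻¹))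
    (hμP : ∀ κE : ZpExtension ↥(fixedField (Subgroup.zpowers v)) p, κE.IsCyclotomic → ClassicalMuVanishes κE)
    (hμD : ∀ κE : ZpExtension ↥(fixedField (Subgroup.zpowers (u * u * v))) p, κE.IsCyclotomic → ClassicalMuVanishes κE)
    (hμX : ∀ κE : ZpExtension ↥(fixedField (Subgroup.zpowers (u * u) ⊔ Subgroup.zpowers v)) p,
      κE.IsCyclotomic → ClassicalMuVanishes κE)
    (hμC : ∀ κE : ZpExtension ↥(fixedField (Subgroup.zpowers (u * v) ⊔ Subgroup.zpowers w)) p,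
      κE.IsCyclotomic → ClassicalMuVanishes κE)
    (κL : ZpExtension L p) (hκL : κL.IsCyclotomic) : ClassicalMuVanishes κL := by
  have hc : Commute u v := huv
  -- steps (4), (5), (3), (2)
  have hμV := classicalMuVanishes_of_isCyclotomic_fixedField_sq_sup_sq hFW hp2 L hp huv hwu hwv hsc hVu hVv hcomm hμX
  have hμ₂ := classicalMuVanishes_of_isCyclotomic_fixedField_zpowers_mul hFW hp2 L hp huv hu4 hw2 hwu hwv hsc hcomm hμC
  have hμM := classicalMuVanishes_of_isCyclotomic_fixedField_zpowers_sq_mul_sq hFW hp2 L hp huv hv4 hsc hcomm hμV hμ₂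
  have hμZ := classicalMuVanishes_of_isCyclotomic_fixedField_zpowers_sq hp2 L hp huv hu4 hμV hμP hμD hμX
  -- step (1): the Klein four `{1, v², u², v²u²}` of `G`, `u² = w v² w⁻¹`
  have hz : v * v * (v * v) = 1 := hv4
  have hb : u * u * (u * u) = 1 := hu4
  have hzb : v * v * (u * u) = u * u * (v * v) := ((hc.symm.mul_right hc.symm).mul_left (hc.symm.mul_right hc.symm)).eq
  have hwvv : w * (v * v) * w⁻¹ = u * u := by
    calc w * (v * v) * w⁻¹ = (w * v * w⁻¹) * (w * v * w⁻¹) := by group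
      _ = u * u := by rw [hwv]
  have hmapw : (Subgroup.zpowers (v * v)).map (MulAut.conj w).toMonoidHom = Subgroup.zpowers (u * u) := by
    rw [MonoidHom.map_zpowers, MulEquiv.coe_toMonoidHom, MulAut.conj_apply, hwvv]
  have hμB := forall_classicalMuVanishes_of_conj hp _ _ w hmapw hμZ
  have heqC : Subgroup.zpowers (u * u) ⊔ Subgroup.zpowers (v * v) = Subgroup.closure {v * v, u * u} := by
    rw [closure_pair_eq_sup, sup_comm]
  exact classicalMuVanishes_of_isCyclotomic_of_biquadratic hp2 L hp hz hb hzb hμZ hμB hμM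
    (forall_classicalMuVanishes_of_subgroup_eq hp heqC hμV) κL hκL

end Literature.NumberTheory.IwasawaTheory

end
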